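import Summits.CriticalPhenomena.PercolationContinuityZ3.Theorems.Transplant.PatternGraphHeisenbergSkew
import HarnessLib

/-!
# Customer (c6) of the pattern-graph front-end in class C2: the FOUR-SHEET HEISENBERG ROTOR PATTERN (the coset picture of
# `Cay(H₃(ℤ) ⋊ C₄; a, b, aρ, bρ)`, `ρ : a ↦ b, b ↦ a⁻¹, c ↦ c`) — `θ_v(p_c) = 0 ∧ p_c < 1` UNCONDITIONALLY

builds on p205010 (kernel theorem, internal audit signed; external expert review pending): through `PatternGraph.criticalContinuity/conj4/drop`
(«PatternGraphOrbits» p496621, design owner p3 g28) over the orbit theorem («AutChartOrbitsCriticalContinuity» p493117 / p495338); the chart is the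
abelianisation `Heis3Skew.abHom` of «PatternGraphHeisenbergSkew» (p496924).  Lane `prim-bschramm`, seat `prim-bschramm-stmt` gen 32 (port pen; row (c6) handed
BY NAME by the design owner p3 g28, P3-NILPOTENT §20.2 / §20.7).  Helper file (`--supports stmt-CriticalPhenomena-4575 --as helper`).

THE GRAPH.  `Γ := Heis3 = H₃(ℤ)`, `k := 4` sheets, chart `c := Heis3Skew.abHom` (`(x, y, z) ↦ (x, y)`).  Let `ρ` be the order-`4` automorphism `a ↦ b`, `b ↦ a⁻¹`
(`c ↦ c`) of `H₃(ℤ)`, so `ρ^i(a) = a, b, a⁻¹, b⁻¹` (`rotA i`) and `ρ^i(b) = ρ^{i+1}(a)` for `i = 0, 1, 2, 3`.  The pattern `rpat i` of sheet `i` consists of the four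
IN-SHEET letters `a^{±1}, b^{±1}` and the two CROSS letters `(ρ^i(a), i+1)`, `(ρ^i(b), i+1) = (rotA i, i+1), (rotA (i+1), i+1)` into sheet `i+1 (mod 4)`:
`0 → 1: a, b`; `1 → 2: b, a⁻¹`; `2 → 3: a⁻¹, b⁻¹`; `3 → 0: b⁻¹, a` (`cross_letters`); the backward bonds are the same bonds read from the other end (the pattern
graph is symmetrised).  So `(h, i) ∼ (h a^{±1}, i)`, `(h, i) ∼ (h b^{±1}, i)`, `(h, i) ∼ (h ρ^i(a), i+1)`, `(h, i) ∼ (h ρ^i(b), i+1)`: degree `8`.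
This is the right Cayley graph of `H₃(ℤ) ⋊ C₄ = {h ρ^i}` on the alphabet `{a^{±1}, b^{±1}, (aρ)^{±1}, (bρ)^{±1}}` read on the four cosets of `H₃(ℤ)`:
`(h ρ^i)·a^{±1} = h ρ^i(a)^{±1} ρ^i`, `(h ρ^i)·b^{±1} = h ρ^i(b)^{±1} ρ^i` (as a SET the in-sheet letters `{ρ^i(a)^{±1}, ρ^i(b)^{±1}}` are `{a^{±1}, b^{±1}}` on every
sheet — the conjugated alphabet is the same set), `(h ρ^i)·(aρ) = h ρ^i(a) ρ^{i+1}`, `(h ρ^i)·(bρ) = h ρ^i(b) ρ^{i+1}` — an identification stated in coordinates,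
NOT typed here; `H₃(ℤ) ⋊ C₄` is virtually nilpotent, not nilpotent, with finite abelianisation.  WORDS (rule P5-SHARPNESS §59.3, P3-NILPOTENT §20.7): the graph
is vertex-transitive (as every Cayley graph); the left `H₃(ℤ)`-translations translate the abelianisation chart and have the four sheets as orbits; whether some
transitive group of automorphisms translates a rank-two chart (which would put the graph under a one-type node, V153 clause 3) is OPEN — so this file is a
CUSTOMER of the orbit theorem and NO 'first' / 'outside every one-type node' word is attached to it.  Kernel content: `θ_v(p_c) = 0`, `p_c < 1` and the
same-`p` drop on the explicit graph `PatternGraph.graph rpat`.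
[cite: BenjaminiSchramm1996, Conj. 4; §2 (Cayley graphs, quasi-transitive graphs)] [cite: KozmaNitzan2024, §4 p. 16 (Lemma 8)]
-/

noncomputable section

namespace Summit.CriticalPhenomena.PercolationContinuityZ3.Theorems.Transplant

open MeasureTheory Literature.Probability.Percolation Literature.Probability.LatticeModels SimpleGraph
open scoped Classical

namespace Heis3RotC4

open Heis3 (gA gB φ)

/-! ## §1 The letters and the pattern -/

/-- `ρ^i(a)` for `i = 0, 1, 2, 3` (`ρ : a ↦ b, b ↦ a⁻¹`): `a, b, a⁻¹, b⁻¹`; and `ρ^i(b) = ρ^{i+1}(a)`. [this work] -/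
def rotA : Fin 4 → Heis3 := ![gA, gB, gA⁻¹, gB⁻¹]

/-- **The pattern of the four-sheet Heisenberg rotor graph**: sheet `i` carries the in-sheet letters `a^{±1}, b^{±1}` and the cross letters `(ρ^i(a), i+1)`,
`(ρ^i(b), i+1)`. [this work] -/
def rpat (i : Fin 4) : Finset (Heis3 × Fin 4) :=
  {(gA, i), (gA⁻¹, i), (gB, i), (gB⁻¹, i), (rotA i, i + 1), (rotA (i + 1), i + 1)}

/-- The table `ρ^i(a) = a, b, a⁻¹, b⁻¹`. [folklore] -/
theorem rotA_table : rotA 0 = gA ∧ rotA 1 = gB ∧ rotA 2 = gA⁻¹ ∧ rotA 3 = gB⁻¹ := ⟨rfl, rfl, rfl, rfl⟩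

/-- **The cross letters of the coset picture**, sheet by sheet: `0 → 1: a, b`; `1 → 2: b, a⁻¹`; `2 → 3: a⁻¹, b⁻¹`; `3 → 0: b⁻¹, a`
(`(h ρ^i)·(aρ) = h ρ^i(a) ρ^{i+1}`, `(h ρ^i)·(bρ) = h ρ^i(b) ρ^{i+1}`). [this work] -/
theorem cross_letters : (rotA 0, rotA (0 + 1)) = (gA, gB) ∧ (rotA 1, rotA (1 + 1)) = (gB, gA⁻¹) ∧
    (rotA 2, rotA (2 + 1)) = (gA⁻¹, gB⁻¹) ∧ (rotA 3, rotA (3 + 1)) = (gB⁻¹, gA) := by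
  decide

/-- Every entry of the table is one of `a^{±1}, b^{±1}`. [folklore] -/
theorem rotA_cases (i : Fin 4) : rotA i = gA ∨ rotA i = gA⁻¹ ∨ rotA i = gB ∨ rotA i = gB⁻¹ := by
  revert i
  decide

/-- The in-sheet letters belong to the pattern of every sheet. [folklore] -/
theorem letter_mem_rpat (i : Fin 4) : (gA, i) ∈ rpat i ∧ (gA⁻¹, i) ∈ rpat i ∧ (gB, i) ∈ rpat i ∧ (gB⁻¹, i) ∈ rpat i := by
  simp [rpat]

/-- The cross letter `(ρ^i(a), i+1)` belongs to the pattern of sheet `i`. [folklore] -/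
theorem cross_mem_rpat (i : Fin 4) : (rotA i, i + 1) ∈ rpat i := by
  simp [rpat]

/-! ## §2 The three obligations of the front-end: unit range, in-sheet axis steps, connectedness -/

/-- **Unit range**: every pattern letter is one of `a^{±1}, b^{±1}`, so its abelianisation has sup-norm `≤ 1`. [folklore] -/
theorem hrange : ∀ i : Fin 4, ∀ p ∈ rpat i, ∀ i' : Fin 2, |Multiplicative.toAdd (Heis3Skew.abHom p.1) i'| ≤ 1 := by
  intro i p hp i'
  rw [Heis3Skew.toAdd_abHom]
  simp only [rpat, Finset.mem_insert, Finset.mem_singleton] at hp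
  rcases hp with rfl | rfl | rfl | rfl | rfl | rfl
  · exact Heis3Skew.abs_φ_letter_le (Or.inl rfl) i'
  · exact Heis3Skew.abs_φ_letter_le (Or.inr (Or.inl rfl)) i'
  · exact Heis3Skew.abs_φ_letter_le (Or.inr (Or.inr (Or.inl rfl))) i'
  · exact Heis3Skew.abs_φ_letter_le (Or.inr (Or.inr (Or.inr rfl))) i'
  · exact Heis3Skew.abs_φ_letter_le (rotA_cases i) i'
  · exact Heis3Skew.abs_φ_letter_le (rotA_cases (i + 1)) i'

/-- **In-sheet axis steps**: every sheet carries `a^{±1}`, `b^{±1}` with abelianisation `± eᵢ` exactly. [folklore] -/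
theorem hstep : ∀ (i : Fin 4) (i' : Fin 2) (σ : ℤˣ), ∃ p ∈ rpat i, p.2 = i ∧
    Multiplicative.toAdd (Heis3Skew.abHom p.1) = Pi.single i' (σ : ℤ) := by
  intro i i' σ
  obtain ⟨hA, hA', hB, hB'⟩ := Heis3Skew.φ_letters
  obtain ⟨mA, mA', mB, mB'⟩ := letter_mem_rpat i
  rcases Int.units_eq_one_or σ with rfl | rfl <;> fin_cases i'
  · exact ⟨(gA, i), mA, rfl, by rw [Heis3Skew.toAdd_abHom, Units.val_one]; exact hA⟩
  · exact ⟨(gB, i), mB, rfl, by rw [Heis3Skew.toAdd_abHom, Units.val_one]; exact hB⟩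
  · exact ⟨(gA⁻¹, i), mA', rfl, by rw [Heis3Skew.toAdd_abHom, Units.val_neg, Units.val_one]; exact hA'⟩
  · exact ⟨(gB⁻¹, i), mB', rfl, by rw [Heis3Skew.toAdd_abHom, Units.val_neg, Units.val_one]; exact hB'⟩

/-- Every vertex of a sheet is joined to the identity vertex of that sheet (the in-sheet letters `a, b` generate `H₃(ℤ)`). [folklore] -/
theorem hsheet (i : Fin 4) (h : Heis3) : (PatternGraph.graph rpat).Reachable ((1 : Heis3), i) (h, i) := by
  refine PatternGraph.reachable_sheet rpat (S := (({gA, gB} : Finset Heis3) : Set Heis3))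
    (Heis3.closure_eq_top_of_mem (by simp) (by simp)) i ?_ h
  intro s hs
  simp only [Finset.coe_insert, Finset.coe_singleton, Set.mem_insert_iff, Set.mem_singleton_iff] at hs
  rcases hs with rfl | rfl
  · exact (letter_mem_rpat i).1
  · exact (letter_mem_rpat i).2.2.1

/-- **A cross letter is a bond**: `(h, i) ∼ (h ρ^i(a), i′)` whenever `i′ = i + 1`. [folklore] -/
theorem reach_cross (h : Heis3) {i i' : Fin 4} (hi : i' = i + 1) :
    (PatternGraph.graph rpat).Reachable (h, i) (h * rotA i, i') := by
  subst hi
  refine (PatternGraph.adj_of_mem rpat (h, i) (cross_mem_rpat i) fun e => ?_).reachable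
  have e2 := congrArg Prod.snd e
  dsimp only at e2
  revert e2
  fin_cases i <;> decide

/-- Every sheet reaches sheet `0` from its identity vertex (cross bonds `i → i+1 → ⋯ → 0`). [folklore] -/
theorem hlink : ∀ i : Fin 4, ∃ h : Heis3, (PatternGraph.graph rpat).Reachable ((1 : Heis3), i) (h, 0) := by
  intro i
  fin_cases i
  · exact ⟨1, Reachable.refl _⟩
  · exact ⟨_, ((reach_cross 1 (i := 1) (i' := 2) (by decide)).trans (reach_cross _ (i := 2) (i' := 3) (by decide))).trans
      (reach_cross _ (i := 3) (i' := 0) (by decide))⟩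
  · exact ⟨_, (reach_cross 1 (i := 2) (i' := 3) (by decide)).trans (reach_cross _ (i := 3) (i' := 0) (by decide))⟩
  · exact ⟨_, reach_cross 1 (i := 3) (i' := 0) (by decide)⟩

/-- **The four-sheet Heisenberg rotor graph is connected.** [folklore] -/
theorem rpat_connected : (PatternGraph.graph rpat).Connected :=
  PatternGraph.connected_of_reach rpat 0 (hsheet 0) hlink

/-! ## §3 The theorems (one application each of the front-end) -/

/-- **THEOREM (unconditional).  `θ_v(p_c) = 0` at every vertex of the four-sheet Heisenberg rotor graph** (the coset picture of
`Cay(H₃(ℤ) ⋊ C₄; a, b, aρ, bρ)`) — by `PatternGraph.criticalContinuity` on the left `H₃(ℤ)`-translations (four orbits, chart = abelianisation, `N = 1`).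
builds on p205010 (kernel theorem, internal audit signed; external expert review pending). [cite: BenjaminiSchramm1996, Conj. 4; §2] -/
theorem criticalContinuity (v : Heis3 × Fin 4) :
    theta (PatternGraph.graph rpat) v (criticalProbIOf (PatternGraph.graph rpat) v) = 0 :=
  PatternGraph.criticalContinuity rpat Heis3Skew.abHom rpat_connected hrange hstep v

/-- **Conj. 4 in its own shape** for the four-sheet Heisenberg rotor graph: `p_c < 1 ∧ θ_v(p_c) = 0`.
builds on p205010 (kernel theorem, internal audit signed; external expert review pending). [cite: BenjaminiSchramm1996, Conj. 4; §2 Conj. 1] -/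
theorem conj4 (v : Heis3 × Fin 4) :
    criticalProb (PatternGraph.graph rpat) v < 1 ∧ theta (PatternGraph.graph rpat) v (criticalProbIOf (PatternGraph.graph rpat) v) = 0 :=
  PatternGraph.conj4 rpat Heis3Skew.abHom rpat_connected hrange hstep v

/-- **… and the same-`p` drop at every vertex.** builds on p205010 (kernel theorem, internal audit signed; external expert review pending).
[cite: BenjaminiSchramm1996, Conj. 4] -/
theorem drop (v : Heis3 × Fin 4) (p : unitInterval) (hθ : 0 < theta (PatternGraph.graph rpat) v p) :
    ∃ q : unitInterval, (q : ℝ) < p ∧ 0 < theta (PatternGraph.graph rpat) v q :=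
  PatternGraph.drop rpat Heis3Skew.abHom rpat_connected hrange hstep v p hθ

end Heis3RotC4

end Summit.CriticalPhenomena.PercolationContinuityZ3.Theorems.Transplant

end
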